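import Summits.ValiantsHypothesis.ValiantsHypothesis.Theorems.FeketeSOSFeketeSOSHardPaleyRIPFlatOfDiscrepancy
import Summits.ValiantsHypothesis.ValiantsHypothesis.Theorems.FeketeSOSFeketeSOSHardPaleyRIPFlatRIPSmallSetDiscrepancy

/-!
# Route FeketeSOS — crux `FeketeSOSHard` (stmt-ValiantsHypothesis-3996), line `paley-rip`,
# stub `stub_paleyFlatRIP`: the engine ⟺ Chung / Chor–Goldreich small-set discrepancy at SOME `α < 1/2`

The engine `stub_paleyFlatRIP` (PaleyRIP beyond `√p`; OPEN) was pinned by the earlier files of this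
seat to flat restricted discrepancy of the Paley sum graph beyond `√p` (`flatRIP_iff_paleySumDiscrepancy`,
`…FlatOfDiscrepancy.lean`), and `…FlatRIPSmallSetDiscrepancy.lean` proved that Chung-type SMALL-SET
discrepancy at ANY exponent `α < 1/2` implies it (Bandeira–Mixon–Moreira 2017, Thm 2.3 (a) ⇒ (b)).
This file proves the CONVERSE and closes the loop, sorry-free:

* `smallSetDiscrepancy_of_paleySumDiscrepancy` — `PaleySumDiscrepancy(κ, δ)` ⇒ small-set discrepancy
  at `α = 1/2 − μ/2 < 1/2`, `β = μ/3`, `μ = min(κ, δ, 1/2)`: for all large `p` and ALL `A, B ⊆ [0,p)`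
  with `#A, #B ≥ p^α`, `|Σ_{a∈A,b∈B} χ_p(a+b)| ≤ (#A·#B)^{1−β/2}`.  Pairs inside the engine's window
  `#A, #B ≤ p^{1/2+δ}` use the flat bound `p^{1/2−κ}√(#A#B)`; pairs with a side above `p^{1/2+δ}`
  have `#A·#B ≥ p^{1+μ/2}` and the unconditional completion bound `√p·√(#A#B)`
  (`charSum_le_sqrt_p_mul`) already saves a power.  (arXiv:2405.08608, ITW 2024, Thm 18/25 takes the
  same step for the Paley ETF, using Karatsuba's theorem in the complementary range to reach every
  `α > 1/2 − κ`; completion suffices for SOME `α < 1/2`, which is all the equivalence needs.)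
* `paleySumDiscrepancy_iff_smallSetDiscrepancy`, `flatRIP_iff_smallSetDiscrepancy` — hence
  **engine ⟺ ∃ α < 1/2, β > 0: small-set discrepancy `(α, β)` of the Paley sum graph**;
* `smallSetDiscrepancy_iff_smallSetDiffDiscrepancy`, `flatRIP_iff_smallSetDiffDiscrepancy` — and, by the
  reflection `B ↦ −B` (`charSum_reflect`, `charSum_reflect'`), the same with the Paley GRAPH pattern
  `χ_p(a−b)`: **engine ⟺ the Paley graph property `𝒫(α, β)` of Chor–Goldreich 1988 / Chung 1994 holds
  for SOME `α < 1/2`** (power-saving two-source extraction below the min-entropy-`1/2` barrier; the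
  format `(#A·#B)^{1−β/2}` and the literature's `C·p^{−β}·#A·#B` agree up to `β ↦ αβ`, `β ↦ β/2` since
  `p^{2α} ≤ #A·#B ≤ p²`).  Known: every `α > 1/2` (Chor–Goldreich; Karatsuba); open: every `α < 1/2`.

So, in kernel: `stub_paleyFlatRIP` ⟺ PaleySumDiscrepancy ⟺ PaleyDiffDiscrepancy ⟺ `∃α<1/2 𝒫_sum(α,β)`
⟺ `∃α<1/2 𝒫(α,β)`, each implying `ω(Paley_p) ≤ p^{1/2−κ}+1` (`…FlatRIPPaleyClique.lean`) — one open
statement in five costumes; the line's engine is exactly "the Paley graph conjecture just below `1/2`".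

Honest framing: equivalences between OPEN statements, landed `--supports` the crux item; the crux
`FeketeSOSHard`, the engine and `stub_tameOperator` remain open; nothing here bears on `VP ≠ VNP`.
-/

-- the line's namespace repeats a path segment by convention (same as the other paley-rip files)
set_option linter.dupNamespace false

namespace Summit.ValiantsHypothesis.ValiantsHypothesis.Theorems.FeketeSOSHardPaleyRIP

open Finset
open scoped BigOperators

noncomputable section

section SmallSetOfDiscrepancy

/-- **Flat discrepancy beyond `√p` ⇒ small-set discrepancy at some exponent `α < 1/2`.**
If `PaleySumDiscrepancy(κ, δ)` holds — `|Σ_{a∈A,b∈B} χ_p(a+b)| ≤ p^{1/2−κ} √(#A·#B)` for all large `p`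
and all `A, B ⊆ [0,p)` of size `≤ p^{1/2+δ}` — then with `μ = min(κ, δ, 1/2)`, `α = 1/2 − μ/2 < 1/2`
and `β = μ/3`: for all large `p` and all `A, B ⊆ [0,p)` with `#A, #B ≥ p^α`,
`|Σ_{a∈A,b∈B} χ_p(a+b)| ≤ (#A·#B)^{1−β/2}` (a power saving over the trivial bound for ALL pairs of sets
above `p^α`; pairs with a side above `p^{1/2+μ}` are handled by the unconditional completion bound
`√p·√(#A·#B)`, `charSum_le_sqrt_p_mul`).  Cf. arXiv:2405.08608 (ITW 2024), Thm 18 / Thm 25, where the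
same step is taken for the Paley ETF with Karatsuba's bound in the complementary range. [folklore] -/
theorem smallSetDiscrepancy_of_paleySumDiscrepancy
    (hD : ∃ κ : ℝ, 0 < κ ∧ ∃ δ : ℝ, 0 < δ ∧ ∃ p₁ : ℕ, ∀ (p : ℕ) [Fact p.Prime], p₁ ≤ p →
      ∀ (A B : Finset ℕ), (∀ a ∈ A, a < p) → (∀ b ∈ B, b < p) →
        (A.card : ℝ) ≤ (p : ℝ) ^ (1 / 2 + δ) → (B.card : ℝ) ≤ (p : ℝ) ^ (1 / 2 + δ) →
        ‖∑ a ∈ A, ∑ b ∈ B, ((legendreSym p ((a : ℤ) + b) : ℤ) : ℂ)‖ ≤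
          (p : ℝ) ^ (1 / 2 - κ) * Real.sqrt ((A.card : ℝ) * B.card)) :
    ∃ α : ℝ, α < 1 / 2 ∧ ∃ β : ℝ, 0 < β ∧ ∃ p₁ : ℕ, ∀ (p : ℕ) [Fact p.Prime], p₁ ≤ p →
      ∀ (A B : Finset ℕ), (∀ a ∈ A, a < p) → (∀ b ∈ B, b < p) →
        (p : ℝ) ^ α ≤ (A.card : ℝ) → (p : ℝ) ^ α ≤ (B.card : ℝ) →
        ‖∑ a ∈ A, ∑ b ∈ B, ((legendreSym p ((a : ℤ) + b) : ℤ) : ℂ)‖ ≤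
          ((A.card : ℝ) * B.card) ^ (1 - β / 2) := by
  classical
  obtain ⟨κ, hκ, δ, hδ, p₁, hD⟩ := hD
  -- one small exponent `μ ≤ κ, δ, 1/2`
  set μ : ℝ := min (min κ δ) (1 / 2) with hμdef
  have hμ : 0 < μ := lt_min (lt_min hκ hδ) (by norm_num)
  have hμκ : μ ≤ κ := (min_le_left _ _).trans (min_le_left _ _)
  have hμδ : μ ≤ δ := (min_le_left _ _).trans (min_le_right _ _)
  have hμ1 : μ ≤ 1 / 2 := min_le_right _ _
  refine ⟨1 / 2 - μ / 2, by linarith, μ / 3, by positivity, p₁, ?_⟩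
  intro p _ hp A B hA hB hAc hBc
  have hprime : p.Prime := Fact.out
  have hp0 : (0 : ℝ) < (p : ℝ) := by exact_mod_cast hprime.pos
  have hp1 : (1 : ℝ) ≤ (p : ℝ) := by exact_mod_cast hprime.one_lt.le
  set x : ℝ := (A.card : ℝ) with hx
  set y : ℝ := (B.card : ℝ) with hy
  have hpα : 0 < (p : ℝ) ^ (1 / 2 - μ / 2) := Real.rpow_pos_of_pos hp0 _
  have hxpos : 0 < x := lt_of_lt_of_le hpα hAc
  have hypos : 0 < y := lt_of_lt_of_le hpα hBc
  have hxy0 : 0 < x * y := mul_pos hxpos hypos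
  -- the product is at least `p^{1−μ}`
  have hxyα : (p : ℝ) ^ (1 - μ) ≤ x * y := by
    have h := mul_le_mul hAc hBc hpα.le hxpos.le
    rwa [← Real.rpow_add hp0, show 1 / 2 - μ / 2 + (1 / 2 - μ / 2) = 1 - μ by ring] at h
  -- target shape: `(xy)^{1−β/2} = (xy)^{(1−β)/2} · √(xy)`
  have hsplit : (x * y) ^ (1 - μ / 3 / 2) = (x * y) ^ ((1 - μ / 3) / 2) * Real.sqrt (x * y) := by
    rw [Real.sqrt_eq_rpow, ← Real.rpow_add hxy0]
    ring_nf
  rw [hsplit]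
  by_cases hsmall : x ≤ (p : ℝ) ^ (1 / 2 + δ) ∧ y ≤ (p : ℝ) ^ (1 / 2 + δ)
  · -- both sides in the engine's window: flat discrepancy, then `p^{1/2−κ} ≤ (xy)^{(1−β)/2}`
    have hmain := hD p hp A B hA hB hsmall.1 hsmall.2
    refine hmain.trans (mul_le_mul_of_nonneg_right ?_ (Real.sqrt_nonneg _))
    calc (p : ℝ) ^ (1 / 2 - κ) ≤ (p : ℝ) ^ ((1 - μ) * ((1 - μ / 3) / 2)) :=
          Real.rpow_le_rpow_of_exponent_le hp1 (by nlinarith)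
      _ = ((p : ℝ) ^ (1 - μ)) ^ ((1 - μ / 3) / 2) := by rw [Real.rpow_mul hp0.le]
      _ ≤ (x * y) ^ ((1 - μ / 3) / 2) :=
          Real.rpow_le_rpow (Real.rpow_nonneg hp0.le _) hxyα (by linarith)
  · -- one side above `p^{1/2+δ}`: completion bound, then `√p ≤ (xy)^{(1−β)/2}`
    have hcompl := charSum_le_sqrt_p_mul p A B hA hB
    refine hcompl.trans (mul_le_mul_of_nonneg_right ?_ (Real.sqrt_nonneg _))
    -- `xy ≥ p^{1/2+δ} · p^{1/2−μ/2} ≥ p^{1+μ/2}`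
    have hbig : (p : ℝ) ^ (1 + μ / 2) ≤ x * y := by
      have hδμ : (p : ℝ) ^ (1 + μ / 2) ≤ (p : ℝ) ^ (1 / 2 + δ) * (p : ℝ) ^ (1 / 2 - μ / 2) := by
        rw [← Real.rpow_add hp0]
        exact Real.rpow_le_rpow_of_exponent_le hp1 (by linarith)
      rw [not_and_or] at hsmall
      rcases hsmall with h | h
      · push Not at h
        exact hδμ.trans (mul_le_mul h.le hBc hpα.le hxpos.le)
      · push Not at h
        rw [mul_comm x y]
        exact hδμ.trans (mul_le_mul h.le hAc hpα.le hypos.le)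
    calc Real.sqrt p = (p : ℝ) ^ (1 / 2 : ℝ) := Real.sqrt_eq_rpow _
      _ ≤ (p : ℝ) ^ ((1 + μ / 2) * ((1 - μ / 3) / 2)) :=
          Real.rpow_le_rpow_of_exponent_le hp1 (by nlinarith)
      _ = ((p : ℝ) ^ (1 + μ / 2)) ^ ((1 - μ / 3) / 2) := by rw [Real.rpow_mul hp0.le]
      _ ≤ (x * y) ^ ((1 - μ / 3) / 2) :=
          Real.rpow_le_rpow (Real.rpow_nonneg hp0.le _) hbig (by linarith)

/-- **Flat discrepancy beyond `√p` ⟺ small-set discrepancy at some `α < 1/2`** (as `∃`-statements over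
the exponents): `→` is `smallSetDiscrepancy_of_paleySumDiscrepancy`, `←` is the exponent step
`paleySumDiscrepancy_of_smallSetDiscrepancy` (`…FlatRIPSmallSetDiscrepancy.lean`). [folklore] -/
theorem paleySumDiscrepancy_iff_smallSetDiscrepancy :
    (∃ κ : ℝ, 0 < κ ∧ ∃ δ : ℝ, 0 < δ ∧ ∃ p₁ : ℕ, ∀ (p : ℕ) [Fact p.Prime], p₁ ≤ p →
      ∀ (A B : Finset ℕ), (∀ a ∈ A, a < p) → (∀ b ∈ B, b < p) →
        (A.card : ℝ) ≤ (p : ℝ) ^ (1 / 2 + δ) → (B.card : ℝ) ≤ (p : ℝ) ^ (1 / 2 + δ) →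
        ‖∑ a ∈ A, ∑ b ∈ B, ((legendreSym p ((a : ℤ) + b) : ℤ) : ℂ)‖ ≤
          (p : ℝ) ^ (1 / 2 - κ) * Real.sqrt ((A.card : ℝ) * B.card)) ↔
    (∃ α : ℝ, α < 1 / 2 ∧ ∃ β : ℝ, 0 < β ∧ ∃ p₁ : ℕ, ∀ (p : ℕ) [Fact p.Prime], p₁ ≤ p →
      ∀ (A B : Finset ℕ), (∀ a ∈ A, a < p) → (∀ b ∈ B, b < p) →
        (p : ℝ) ^ α ≤ (A.card : ℝ) → (p : ℝ) ^ α ≤ (B.card : ℝ) →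
        ‖∑ a ∈ A, ∑ b ∈ B, ((legendreSym p ((a : ℤ) + b) : ℤ) : ℂ)‖ ≤
          ((A.card : ℝ) * B.card) ^ (1 - β / 2)) :=
  ⟨smallSetDiscrepancy_of_paleySumDiscrepancy, paleySumDiscrepancy_of_smallSetDiscrepancy⟩

/-- **The engine ⟺ Chung-type small-set discrepancy of the Paley sum graph at SOME exponent `α < 1/2`**
(as `∃`-statements): the registered statement of `stub_paleyFlatRIP` holds iff there are `α < 1/2`,
`β > 0` with `|Σ_{a∈A,b∈B} χ_p(a+b)| ≤ (#A·#B)^{1−β/2}` for all large `p` and all `A, B ⊆ [0,p)` of size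
`≥ p^α`.  `α = 1/2` (and beyond) is Chung's exponent-`1/2` barrier / the Karatsuba range; every
`α < 1/2` is open (Chung 1994 Conj. 2.2 asks for all `α > 0`). [folklore] -/
theorem flatRIP_iff_smallSetDiscrepancy :
    (∃ κ : ℝ, 0 < κ ∧ ∃ δ₁ : ℝ, 0 < δ₁ ∧ ∃ p₁ : ℕ, ∀ (p : ℕ) [Fact p.Prime], p₁ ≤ p →
      ∀ (S : Finset ℕ), (∀ a ∈ S, a < p) → (S.card : ℝ) ≤ (p : ℝ) ^ (1 / 2 + δ₁) →
      ∀ (w : ℕ → ℂ), ‖paleyForm p S w‖ ≤ (p : ℝ) ^ (1 / 2 - κ) * ∑ a ∈ S, ‖w a‖ ^ 2) ↔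
    (∃ α : ℝ, α < 1 / 2 ∧ ∃ β : ℝ, 0 < β ∧ ∃ p₁ : ℕ, ∀ (p : ℕ) [Fact p.Prime], p₁ ≤ p →
      ∀ (A B : Finset ℕ), (∀ a ∈ A, a < p) → (∀ b ∈ B, b < p) →
        (p : ℝ) ^ α ≤ (A.card : ℝ) → (p : ℝ) ^ α ≤ (B.card : ℝ) →
        ‖∑ a ∈ A, ∑ b ∈ B, ((legendreSym p ((a : ℤ) + b) : ℤ) : ℂ)‖ ≤
          ((A.card : ℝ) * B.card) ^ (1 - β / 2)) :=
  flatRIP_iff_paleySumDiscrepancy.trans paleySumDiscrepancy_iff_smallSetDiscrepancy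

/-- **Sum ⟺ difference for small-set discrepancy** (same exponents): reflecting `B ↦ −B (mod p)` inside
`[0,p)` preserves `#B` and swaps `χ_p(a+b)` with `χ_p(a−b)`; so the SUM-graph statement above is the
Paley-GRAPH property `𝒫(α, β)` of Chor–Goldreich / Chung (power saving for all vertex-set pairs above
`p^α`). [folklore] -/
theorem smallSetDiscrepancy_iff_smallSetDiffDiscrepancy :
    (∃ α : ℝ, α < 1 / 2 ∧ ∃ β : ℝ, 0 < β ∧ ∃ p₁ : ℕ, ∀ (p : ℕ) [Fact p.Prime], p₁ ≤ p →
      ∀ (A B : Finset ℕ), (∀ a ∈ A, a < p) → (∀ b ∈ B, b < p) →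
        (p : ℝ) ^ α ≤ (A.card : ℝ) → (p : ℝ) ^ α ≤ (B.card : ℝ) →
        ‖∑ a ∈ A, ∑ b ∈ B, ((legendreSym p ((a : ℤ) + b) : ℤ) : ℂ)‖ ≤
          ((A.card : ℝ) * B.card) ^ (1 - β / 2)) ↔
    (∃ α : ℝ, α < 1 / 2 ∧ ∃ β : ℝ, 0 < β ∧ ∃ p₁ : ℕ, ∀ (p : ℕ) [Fact p.Prime], p₁ ≤ p →
      ∀ (A B : Finset ℕ), (∀ a ∈ A, a < p) → (∀ b ∈ B, b < p) →
        (p : ℝ) ^ α ≤ (A.card : ℝ) → (p : ℝ) ^ α ≤ (B.card : ℝ) →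
        ‖∑ a ∈ A, ∑ b ∈ B, ((legendreSym p ((a : ℤ) - b) : ℤ) : ℂ)‖ ≤
          ((A.card : ℝ) * B.card) ^ (1 - β / 2)) := by
  classical
  constructor
  · rintro ⟨α, hα, β, hβ, p₁, hD⟩
    refine ⟨α, hα, β, hβ, p₁, ?_⟩
    intro p _ hp A B hA hBp hAc hBc
    have h := hD p hp A (B.image (fun b : ℕ => (p - b) % p)) hA (reflect_lt p B)
      hAc (by rw [card_reflect p B hBp]; exact hBc)
    rwa [charSum_reflect p A B hBp, card_reflect p B hBp] at h
  · rintro ⟨α, hα, β, hβ, p₁, hD⟩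
    refine ⟨α, hα, β, hβ, p₁, ?_⟩
    intro p _ hp A B hA hBp hAc hBc
    have h := hD p hp A (B.image (fun b : ℕ => (p - b) % p)) hA (reflect_lt p B)
      hAc (by rw [card_reflect p B hBp]; exact hBc)
    rwa [charSum_reflect' p A B hBp, card_reflect p B hBp] at h

/-- **The engine ⟺ the Paley graph property `𝒫(α, β)` for SOME `α < 1/2`** (as `∃`-statements): the
registered `stub_paleyFlatRIP` holds iff there are `α < 1/2`, `β > 0` such that for all large primes `p`
and all `A, B ⊆ [0,p)` with `#A, #B ≥ p^α`: `|Σ_{a∈A,b∈B} χ_p(a−b)| ≤ (#A·#B)^{1−β/2}` — a 2-source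
extractor / discrepancy bound for the Paley graph BELOW the min-entropy-`1/2` barrier (Chor–Goldreich
1988 proved `α > 1/2`; `α < 1/2` open; arXiv:2405.08608 derives it from Paley-ETF RIP beyond `√p`,
which is this engine). [folklore] -/
theorem flatRIP_iff_smallSetDiffDiscrepancy :
    (∃ κ : ℝ, 0 < κ ∧ ∃ δ₁ : ℝ, 0 < δ₁ ∧ ∃ p₁ : ℕ, ∀ (p : ℕ) [Fact p.Prime], p₁ ≤ p →
      ∀ (S : Finset ℕ), (∀ a ∈ S, a < p) → (S.card : ℝ) ≤ (p : ℝ) ^ (1 / 2 + δ₁) →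
      ∀ (w : ℕ → ℂ), ‖paleyForm p S w‖ ≤ (p : ℝ) ^ (1 / 2 - κ) * ∑ a ∈ S, ‖w a‖ ^ 2) ↔
    (∃ α : ℝ, α < 1 / 2 ∧ ∃ β : ℝ, 0 < β ∧ ∃ p₁ : ℕ, ∀ (p : ℕ) [Fact p.Prime], p₁ ≤ p →
      ∀ (A B : Finset ℕ), (∀ a ∈ A, a < p) → (∀ b ∈ B, b < p) →
        (p : ℝ) ^ α ≤ (A.card : ℝ) → (p : ℝ) ^ α ≤ (B.card : ℝ) →
        ‖∑ a ∈ A, ∑ b ∈ B, ((legendreSym p ((a : ℤ) - b) : ℤ) : ℂ)‖ ≤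
          ((A.card : ℝ) * B.card) ^ (1 - β / 2)) :=
  flatRIP_iff_smallSetDiscrepancy.trans smallSetDiscrepancy_iff_smallSetDiffDiscrepancy

end SmallSetOfDiscrepancy

end

end Summit.ValiantsHypothesis.ValiantsHypothesis.Theorems.FeketeSOSHardPaleyRIP
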